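/-
COR-CM (cell pub-hodgecm2, stage 2 of the Hodge ladder) — count-neutral KERNEL SCHEMA «INT-2 from ONE face per orbit of type
squares» (seat prover-pub-hodgecm2-b23-g31-0, binder prover b23, gen 31; claim INT2-ORBIT, HOME/lit/LIT-STATUS.md
2026-08-21T14:03:32Z; sequel of `CorCM/FacePeriodsGeneratingSet.lean` p274957 and `CorCM/FaceCharacterReads.lean`).  Theorems
only; no definition, no named fact, nothing asserted; NOT an E term, NOT a display of record, no BINDER-OWNERS row;
`Interfaces.lean` (C1), `Assembly/ModelChain*.lean`, B01, `Transposition/*` and every `StubTree/*` file untouched.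
HONEST FRAMING (COORDINATOR RULING — HODGE FRAMING CORRECTION, 2026-08-21T11:55:35Z): `HC_CM` is NOT proved, here or anywhere in the
tree.  This file proves NO face period; it records how few face periods of ONE Galois CM field `F` the `F`-generated CM slice of
the Hodge conjecture needs — one per `Aut(F)`-orbit of type squares — and in which algebraic form a smaller generating set enters.
-/
import Summits.HodgeConjecture.CorCM.FacePeriodsGeneratingSet
import Summits.HodgeConjecture.CorCM.FaceCharacterReads
import Summits.HodgeConjecture.CorCM.CMSliceExhaustion
import HarnessLib

/-!
# Face periods on ONE face per `Aut(F)`-orbit of type squares ⟹ the `F`-generated CM slice of the Hodge conjecture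

`CorCM/FacePeriodsGeneratingSet.lean` reduces the `F`-slice (`U.HC (∏_j A_{(F,Θ_j)})` for every finite family `Θ` of CM types of
ONE Galois CM field `F`, `6 ≤ [F:ℚ]`) to the algebraicity of the Weil lines of a SET `𝒮` of faces, under the generation binder

  `hgen : ∀ f, lefChar f.corner (fun _ => {σ₀}) ∈ AddSubgroup.closure {lefChar g.corner (fun _ => {σ}) | g ∈ 𝒮, σ}`.

`CorCM/FaceCharacterReads.lean` discharges `hgen` (at every `σ₀`) in two shapes, and this file plugs both in:

* §1/§2 ORBIT FORM — `𝒮` meets every `Aut(F)`-orbit of type squares: every face `f` of `F` shares its type square (seat b07's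
  hypotheses `hpl`/`hΦ` of `periodNV_iff_of_sameSquare`, verbatim) with a Galois twist `g·τ` (seat b06's `Face.twist`) of some
  `g ∈ 𝒮`.  Then Weil-line algebraicity / ONE period witness / ONE face-theta datum per face OF `𝒮` gives the whole `F`-slice:
  abstract universe `Universe.hc_cmProd_of_squareOrbits[_of_exists_periodNV]`; CLOSED on the universe of record
  `hodgeConjectureFor_of_avDominatedBy_isProductOf_of_exists_facePeriod_on_squareOrbits` (headline) with its Weil-line and socket
  variants.  The mechanism is the CHARACTER calculus of [QW8] Thm 2.5 — no period is transported and no hermitian space is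
  relabelled (contrast seat b06's witness-level `Model.periodNV_face_twist`, which moves the datum itself); each representative
  keeps its own admissible `ι₁`, its own `V`, its own level.  Seat b30's census (HOME/lit/LIT-STATUS.md OCTIC-FACE-CENSUS (a))
  counts `3·4·4·6·5·3` orbits of type squares for the six Galois types of degree `8` (against `192` faces / `24` squares each).
* §3 CERTIFICATE FORM — `ker (typeSum (GalT F) conjT) ≤ span ℤ {gface-reads of 𝒮} ⊔ pairRel` (the face relations of `𝒮` and
  their translates generate rfwf's relation lattice modulo pairs): the algebraic statement a finite census certificate must
  deliver for a generating set SMALLER than a system of orbit representatives (b30 (d): `1·2·2·3·2·2` at degree `8`); abstract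
  `Universe.hc_cmProd_of_ker_le` and CLOSED `hodgeConjectureFor_of_avDominatedBy_isProductOf_of_exists_facePeriod_of_ker_le`.

* §4 GLOBAL PER-ORBIT FORM — the slice theorem for the products `∏_j A_{(K,Θ_j)}` themselves and, through seat b24's exhaustion
  `SliceExhaustion.hc_cm_of_forall_galois_cmProdAV` (`CorCM/CMSliceExhaustion.lean`), the chain read per orbit:
  `hc_cm_of_exists_facePeriod_on_squareOrbits` — (for every Galois CM field `K` with `6 ≤ [K:ℚ]`, a set of faces meeting every
  `Aut(K)`-orbit of type squares with ONE period witness per member) ⟹ `HC_CM`; certificate variant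
  `hc_cm_of_exists_facePeriod_of_ker_le`.  Compare the all-faces form `hc_cm_closed_of_exists_facePeriod`
  (`CorCM/FacePeriodWitnesses.lean` :189).  Conditional reductions only; `HC_CM` is NOT proved.

Nothing is lost: `𝒮 = Set.univ` satisfies the orbit hypothesis (`squareOrbits_univ`).

References: [QW8] Thm 2.5 (kernel `StubTree/Qw8*.lean`); rfwf v3 `l:allg` (kernel `Prior/AllgGroup*`); [cite: Pohlmann1968, Thm. 1];
[cite: Milne1999LefschetzClasses, Thm. 3.2 and Cor. 4.5]; [cite: Shimura1998, §6.2 Theorem 3 (pp. 41–43)].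
-/

noncomputable section

open CategoryTheory NumberField
open Literature.AlgebraicGeometry Literature.AlgebraicGeometry.Motives Literature.AlgebraicGeometry.HodgeTheory
open Literature.AlgebraicGeometry.ComplexMultiplication Literature.AlgebraicGeometry.Milne1999
open Literature.NumberTheory.Automorphic
open Literature.NumberTheory.Automorphic.PicardCM
open Literature.NumberTheory.ComplexMultiplication.CMTypeOps (flip)
open Summit.HodgeConjecture.CorCM.Prior.AllgGroup.RfwfAllgGroup (gface typeSum CMF)

namespace Summit.HodgeConjecture.CorCM

/-! ## §1 Abstract universe: the face reduction from one face per orbit of type squares -/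

namespace Universe

variable {U : Universe}

/-- **FACE REDUCTION FROM ONE FACE PER ORBIT OF TYPE SQUARES (abstract).**  On a universe with Pohlmann's span theorem and the
five [QW8] steps: for ONE Galois CM field `F` with `6 ≤ [F:ℚ]` and a set `𝒮` of faces of `F` such that every face of `F` shares its
type square with a Galois twist of a face of `𝒮`, the algebraicity of the Weil lines `W_F(P(g))`, `g ∈ 𝒮`, implies
`U.HC (∏_j A_{(F,Θ_j)})` in every codimension for every finite family `Θ` of CM types of `F`
(`hc_cmProd_of_faceSet` with `hgen` discharged by `lefChar_corner_mem_closure_of_squareOrbits`). [cite: Pohlmann1968, Thm. 1]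
[cite: Milne1999LefschetzClasses, Thm. 3.2 and Cor. 4.5] -/
theorem hc_cmProd_of_squareOrbits (hP : U.PohlmannSpan) (hC : U.Qw8Conj) (hE : U.Qw8ExtProd) (hD : U.Qw8DualPushPull)
    (hM : U.Qw8Milne) (hB : U.Qw8FaceBridge) {F : CMField} (hGal : IsGalois ℚ F) (h6 : 6 ≤ Module.finrank ℚ F)
    (𝒮 : Set (Face F))
    (hrep : ∀ f : Face F, ∃ g ∈ 𝒮, ∃ τ : F ≃+* F,
      ((InfinitePlace.mk f.p = InfinitePlace.mk (g.twist τ).p ∧ InfinitePlace.mk f.p' = InfinitePlace.mk (g.twist τ).p') ∨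
        (InfinitePlace.mk f.p = InfinitePlace.mk (g.twist τ).p' ∧ InfinitePlace.mk f.p' = InfinitePlace.mk (g.twist τ).p)) ∧
      (f.Φ = (g.twist τ).Φ ∨ f.Φ = flip (g.twist τ).p (g.twist τ).Φ ∨ f.Φ = flip (g.twist τ).p' (g.twist τ).Φ ∨
        f.Φ = flip (g.twist τ).p' (flip (g.twist τ).p (g.twist τ).Φ)))
    (hWeil : ∀ f ∈ 𝒮, U.WeilFaceAlgebraic F f) {n : ℕ} (Θ : Fin (n + 1) → CMType F) : U.HC (U.cmProd F Θ) :=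
  hc_cmProd_of_faceSet hP hC hE hD hM hB hGal h6 𝒮 (Classical.arbitrary ((F : Type) →+* ℂ))
    (lefChar_corner_mem_closure_of_squareOrbits 𝒮 hrep _) hWeil Θ

/-- **… from ONE period witness per face of `𝒮`** (the per-face atom `weilFaceAlgebraic_of_exists_periodNV` of
`CorCM/FacePeriodsFieldLocal.lean`: some admissible `ι₁`, some hermitian 3-space `V`, some level, eigenforms at some `σ`, chosen
independently for each representative). [cite: Pohlmann1968, Thm. 1] [cite: Shimura1998, §6.2 Theorem 3 (pp. 41–43)] -/
theorem hc_cmProd_of_squareOrbits_of_exists_periodNV (hP : U.PohlmannSpan) (hC : U.Qw8Conj) (hE : U.Qw8ExtProd)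
    (hD : U.Qw8DualPushPull) (hM : U.Qw8Milne) (hB : U.Qw8FaceBridge) (hEig : U.Fact_eigenLine) (hA : U.Fact_alphaLine)
    (h22 : U.SurfaceCriterion) (hdim : U.PmsDimTwo) {F : CMField} (hGal : IsGalois ℚ F) (h6 : 6 ≤ Module.finrank ℚ F)
    (𝒮 : Set (Face F))
    (hrep : ∀ f : Face F, ∃ g ∈ 𝒮, ∃ τ : F ≃+* F,
      ((InfinitePlace.mk f.p = InfinitePlace.mk (g.twist τ).p ∧ InfinitePlace.mk f.p' = InfinitePlace.mk (g.twist τ).p') ∨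
        (InfinitePlace.mk f.p = InfinitePlace.mk (g.twist τ).p' ∧ InfinitePlace.mk f.p' = InfinitePlace.mk (g.twist τ).p)) ∧
      (f.Φ = (g.twist τ).Φ ∨ f.Φ = flip (g.twist τ).p (g.twist τ).Φ ∨ f.Φ = flip (g.twist τ).p' (g.twist τ).Φ ∨
        f.Φ = flip (g.twist τ).p' (flip (g.twist τ).p (g.twist τ).Φ)))
    (hwit : ∀ f ∈ 𝒮, ∃ ι₁ : F →+* ℂ, f.Admissible ι₁ ∧ ∃ (V : HermSpace3 F ι₁) (σ : F →+* ℂ),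
      U.PeriodNV ι₁ V F f.psi σ)
    {n : ℕ} (Θ : Fin (n + 1) → CMType F) : U.HC (U.cmProd F Θ) :=
  hc_cmProd_of_faceSet_of_exists_periodNV hP hC hE hD hM hB hEig hA h22 hdim hGal h6 𝒮
    (Classical.arbitrary ((F : Type) →+* ℂ)) (lefChar_corner_mem_closure_of_squareOrbits 𝒮 hrep _) hwit Θ

/-- **FACE REDUCTION FROM A GENERATION CERTIFICATE (abstract).**  Same conclusion when, instead of orbit representatives, the face
relations of the faces of `𝒮` read at all base embeddings, together with the pair relations, span a submodule of `ℤ[types]`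
containing the relation lattice `ker (typeSum (GalT F) conjT)` (`lefChar_corner_mem_closure_of_ker_le`).
[cite: Pohlmann1968, Thm. 1] [cite: Milne1999LefschetzClasses, Thm. 3.2 and Cor. 4.5] -/
theorem hc_cmProd_of_ker_le (hP : U.PohlmannSpan) (hC : U.Qw8Conj) (hE : U.Qw8ExtProd) (hD : U.Qw8DualPushPull)
    (hM : U.Qw8Milne) (hB : U.Qw8FaceBridge) {F : CMField} (hGal : IsGalois ℚ F) (h6 : 6 ≤ Module.finrank ℚ F)
    (𝒮 : Set (Face F))
    (hspan : LinearMap.ker (typeSum (GalT F) conjT) ≤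
      Submodule.span ℤ {y : CMF (GalT F) conjT →₀ ℤ | ∃ g ∈ 𝒮, ∃ σ : (F : Type) →+* ℂ,
          y = gface conjT conjT_mul_self (pullType g.Φ σ) (translate σ g.p) (translate σ g.p')} ⊔ pairRel)
    (hWeil : ∀ f ∈ 𝒮, U.WeilFaceAlgebraic F f) {n : ℕ} (Θ : Fin (n + 1) → CMType F) : U.HC (U.cmProd F Θ) :=
  haveI := hGal
  hc_cmProd_of_faceSet hP hC hE hD hM hB hGal h6 𝒮 (Classical.arbitrary ((F : Type) →+* ℂ))
    (lefChar_corner_mem_closure_of_ker_le 𝒮 hspan _) hWeil Θ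

end Universe

/-! ## §2 CLOSED forms on the universe of record: one face per orbit of type squares -/

open Summit.HodgeConjecture.CorCM.Domination

/-- **INT-2 FROM ONE FACE PER ORBIT OF TYPE SQUARES, CLOSED — Weil-line form.**  For ONE Galois CM field `K` with `6 ≤ [K:ℚ]` and
a set `𝒮` of faces of `K` meeting every `Aut(K)`-orbit of type squares (every face of `K` shares its square with a Galois twist of a
face of `𝒮`): if the Weil lines `W_K(P(g))`, `g ∈ 𝒮`, are algebraic on the universe of record (model data = the tree theorems
`exists_isReal_hodgeModel_holds`, `hodgePQ_independent_of_hodgeModel_holds`, `BallQuotient.ballQuotientUniformised_holds`,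
`cmAbelianVarietyRealised_holds`), then every complex abelian variety dominated by a finite product of realisations of CM types of
CM fields embeddable in `K` satisfies the Hodge conjecture in every codimension.
[cite: Shimura1998, §6.2 Theorem 3 and §6.1 Corollary of Theorem 2 (pp. 41–43)] [cite: Pohlmann1968, Thm. 1]
[cite: Milne1999LefschetzClasses, Thm. 3.2 and Cor. 4.5] [cite: MumfordAV1970, §19 Thm. 1 and p. 169] -/
theorem hodgeConjectureFor_of_avDominatedBy_isProductOf_of_weilFaceAlgebraic_on_squareOrbits (K : CMField) [hGal : IsGalois ℚ K]
    (h6 : 6 ≤ Module.finrank ℚ K) (𝒮 : Set (Face K))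
    (hrep : ∀ f : Face K, ∃ g ∈ 𝒮, ∃ τ : K ≃+* K,
      ((InfinitePlace.mk f.p = InfinitePlace.mk (g.twist τ).p ∧ InfinitePlace.mk f.p' = InfinitePlace.mk (g.twist τ).p') ∨
        (InfinitePlace.mk f.p = InfinitePlace.mk (g.twist τ).p' ∧ InfinitePlace.mk f.p' = InfinitePlace.mk (g.twist τ).p)) ∧
      (f.Φ = (g.twist τ).Φ ∨ f.Φ = flip (g.twist τ).p (g.twist τ).Φ ∨ f.Φ = flip (g.twist τ).p' (g.twist τ).Φ ∨
        f.Φ = flip (g.twist τ).p' (flip (g.twist τ).p (g.twist τ).Φ)))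
    (hWeil : ∀ f ∈ 𝒮, (Model.picardCMUniverse exists_isReal_hodgeModel_holds hodgePQ_independent_of_hodgeModel_holds
      BallQuotient.ballQuotientUniformised_holds cmAbelianVarietyRealised_holds).WeilFaceAlgebraic K f)
    {P A : AbelianVariety ℂ} (hP : AbelianVariety.IsProductOf (fun B : AbelianVariety ℂ =>
      ∃ (E : Type) (_ : Field E) (_ : NumberField E) (_ : IsCMField E) (_ : E →+* (K : Type)) (Φ : CMType E)
        (ι : 𝓞 E →+* End B) (θ : E →+* Module.End ℂ (complexBetti B.X 1)),
        IsCMTypeRealisation Φ B ι θ) P)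
    (hA : AVDominatedBy A P) : HodgeConjectureFor A.dim A.X :=
  hodgeConjectureFor_of_avDominatedBy_isProductOf_of_weilFaceAlgebraic_on K h6 𝒮 (Classical.arbitrary ((K : Type) →+* ℂ))
    (lefChar_corner_mem_closure_of_squareOrbits 𝒮 hrep _) hWeil hP hA

/-- **INT-2 FROM ONE FACE PER ORBIT OF TYPE SQUARES, CLOSED — period-witness form (headline).**  For ONE Galois CM field `K` with
`6 ≤ [K:ℚ]` and a set `𝒮` of faces of `K` meeting every `Aut(K)`-orbit of type squares: ONE period witness per face OF `𝒮` on the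
universe of record — for each representative its own admissible `ι₁`, its own hermitian 3-space `V`, its own level, eigenforms at
its own `σ` — implies the Hodge conjecture, in every codimension, for every complex abelian variety `A` dominated by a finite
product of abelian varieties each realising a CM type of a CM field `E` with `E →+* K`.  NO other hypothesis (the generation binder
of `CorCM/FacePeriodsGeneratingSet.lean` is discharged by the orbit hypothesis; no period transport).  FRAMING: a statement about
the abelian varieties generated by ONE field `K`, conditional on the face periods of `𝒮`; `HC_CM` is not proved.
[cite: Shimura1998, §6.2 Theorem 3 and §6.1 Corollary of Theorem 2 (pp. 41–43)] [cite: Pohlmann1968, Thm. 1]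
[cite: Milne1999LefschetzClasses, Thm. 3.2 and Cor. 4.5] [cite: MumfordAV1970, §19 Thm. 1 and p. 169] -/
theorem hodgeConjectureFor_of_avDominatedBy_isProductOf_of_exists_facePeriod_on_squareOrbits (K : CMField)
    [hGal : IsGalois ℚ K] (h6 : 6 ≤ Module.finrank ℚ K) (𝒮 : Set (Face K))
    (hrep : ∀ f : Face K, ∃ g ∈ 𝒮, ∃ τ : K ≃+* K,
      ((InfinitePlace.mk f.p = InfinitePlace.mk (g.twist τ).p ∧ InfinitePlace.mk f.p' = InfinitePlace.mk (g.twist τ).p') ∨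
        (InfinitePlace.mk f.p = InfinitePlace.mk (g.twist τ).p' ∧ InfinitePlace.mk f.p' = InfinitePlace.mk (g.twist τ).p)) ∧
      (f.Φ = (g.twist τ).Φ ∨ f.Φ = flip (g.twist τ).p (g.twist τ).Φ ∨ f.Φ = flip (g.twist τ).p' (g.twist τ).Φ ∨
        f.Φ = flip (g.twist τ).p' (flip (g.twist τ).p (g.twist τ).Φ)))
    (h : ∀ f ∈ 𝒮, ∃ ι₁ : K →+* ℂ, f.Admissible ι₁ ∧ ∃ (V : HermSpace3 K ι₁) (σ : K →+* ℂ),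
      (Model.picardCMUniverse exists_isReal_hodgeModel_holds hodgePQ_independent_of_hodgeModel_holds
        BallQuotient.ballQuotientUniformised_holds cmAbelianVarietyRealised_holds).PeriodNV ι₁ V K f.psi σ)
    {P A : AbelianVariety ℂ} (hP : AbelianVariety.IsProductOf (fun B : AbelianVariety ℂ =>
      ∃ (E : Type) (_ : Field E) (_ : NumberField E) (_ : IsCMField E) (_ : E →+* (K : Type)) (Φ : CMType E)
        (ι : 𝓞 E →+* End B) (θ : E →+* Module.End ℂ (complexBetti B.X 1)),
        IsCMTypeRealisation Φ B ι θ) P)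
    (hA : AVDominatedBy A P) : HodgeConjectureFor A.dim A.X :=
  hodgeConjectureFor_of_avDominatedBy_isProductOf_of_exists_facePeriod_on K h6 𝒮 (Classical.arbitrary ((K : Type) →+* ℂ))
    (lefChar_corner_mem_closure_of_squareOrbits 𝒮 hrep _) h hP hA

/-- **Socket form** of the headline: ONE face-scoped theta datum (`FaceThetaDatum`, `CorCM/B01/ThetaRealisationSocket.lean`) per
face OF `𝒮`. [cite: Shimura1998, §6.2 Theorem 3 and §6.1 Corollary of Theorem 2 (pp. 41–43)] [cite: Pohlmann1968, Thm. 1] -/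
theorem hodgeConjectureFor_of_avDominatedBy_isProductOf_of_faceThetaData_on_squareOrbits (K : CMField) [hGal : IsGalois ℚ K]
    (h6 : 6 ≤ Module.finrank ℚ K) (𝒮 : Set (Face K))
    (hrep : ∀ f : Face K, ∃ g ∈ 𝒮, ∃ τ : K ≃+* K,
      ((InfinitePlace.mk f.p = InfinitePlace.mk (g.twist τ).p ∧ InfinitePlace.mk f.p' = InfinitePlace.mk (g.twist τ).p') ∨
        (InfinitePlace.mk f.p = InfinitePlace.mk (g.twist τ).p' ∧ InfinitePlace.mk f.p' = InfinitePlace.mk (g.twist τ).p)) ∧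
      (f.Φ = (g.twist τ).Φ ∨ f.Φ = flip (g.twist τ).p (g.twist τ).Φ ∨ f.Φ = flip (g.twist τ).p' (g.twist τ).Φ ∨
        f.Φ = flip (g.twist τ).p' (flip (g.twist τ).p (g.twist τ).Φ)))
    (h : ∀ f ∈ 𝒮, ∃ ι₁ : K →+* ℂ, f.Admissible ι₁ ∧ ∃ V : HermSpace3 K ι₁,
      Nonempty ((Model.picardCMUniverse exists_isReal_hodgeModel_holds hodgePQ_independent_of_hodgeModel_holds
        BallQuotient.ballQuotientUniformised_holds cmAbelianVarietyRealised_holds).FaceThetaDatum ι₁ V K f.psi ι₁))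
    {P A : AbelianVariety ℂ} (hP : AbelianVariety.IsProductOf (fun B : AbelianVariety ℂ =>
      ∃ (E : Type) (_ : Field E) (_ : NumberField E) (_ : IsCMField E) (_ : E →+* (K : Type)) (Φ : CMType E)
        (ι : 𝓞 E →+* End B) (θ : E →+* Module.End ℂ (complexBetti B.X 1)),
        IsCMTypeRealisation Φ B ι θ) P)
    (hA : AVDominatedBy A P) : HodgeConjectureFor A.dim A.X :=
  hodgeConjectureFor_of_avDominatedBy_isProductOf_of_faceThetaData_on K h6 𝒮 (Classical.arbitrary ((K : Type) →+* ℂ))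
    (lefChar_corner_mem_closure_of_squareOrbits 𝒮 hrep _) h hP hA

/-! ## §3 CLOSED form on the universe of record: a generation certificate -/

/-- **INT-2 FROM A GENERATION CERTIFICATE, CLOSED — period-witness form.**  For ONE Galois CM field `K` with `6 ≤ [K:ℚ]` and a set
`𝒮` of faces of `K` whose face relations, read at all base embeddings, span together with the pair relations a submodule of
`ℤ[types of (GalT K, c)]` containing the relation lattice `ker (typeSum (GalT K) conjT)`: ONE period witness per face of `𝒮` on the
universe of record implies the Hodge conjecture, in every codimension, for every complex abelian variety dominated by a finite
product of realisations of CM types of CM fields embeddable in `K`.  (The form a finite census certificate feeds; `HC_CM` is not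
proved.) [cite: Shimura1998, §6.2 Theorem 3 and §6.1 Corollary of Theorem 2 (pp. 41–43)] [cite: Pohlmann1968, Thm. 1]
[cite: Milne1999LefschetzClasses, Thm. 3.2 and Cor. 4.5] -/
theorem hodgeConjectureFor_of_avDominatedBy_isProductOf_of_exists_facePeriod_of_ker_le (K : CMField) [hGal : IsGalois ℚ K]
    (h6 : 6 ≤ Module.finrank ℚ K) (𝒮 : Set (Face K))
    (hspan : LinearMap.ker (typeSum (GalT K) conjT) ≤
      Submodule.span ℤ {y : CMF (GalT K) conjT →₀ ℤ | ∃ g ∈ 𝒮, ∃ σ : (K : Type) →+* ℂ,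
          y = gface conjT conjT_mul_self (pullType g.Φ σ) (translate σ g.p) (translate σ g.p')} ⊔ pairRel)
    (h : ∀ f ∈ 𝒮, ∃ ι₁ : K →+* ℂ, f.Admissible ι₁ ∧ ∃ (V : HermSpace3 K ι₁) (σ : K →+* ℂ),
      (Model.picardCMUniverse exists_isReal_hodgeModel_holds hodgePQ_independent_of_hodgeModel_holds
        BallQuotient.ballQuotientUniformised_holds cmAbelianVarietyRealised_holds).PeriodNV ι₁ V K f.psi σ)
    {P A : AbelianVariety ℂ} (hP : AbelianVariety.IsProductOf (fun B : AbelianVariety ℂ =>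
      ∃ (E : Type) (_ : Field E) (_ : NumberField E) (_ : IsCMField E) (_ : E →+* (K : Type)) (Φ : CMType E)
        (ι : 𝓞 E →+* End B) (θ : E →+* Module.End ℂ (complexBetti B.X 1)),
        IsCMTypeRealisation Φ B ι θ) P)
    (hA : AVDominatedBy A P) : HodgeConjectureFor A.dim A.X :=
  hodgeConjectureFor_of_avDominatedBy_isProductOf_of_exists_facePeriod_on K h6 𝒮 (Classical.arbitrary ((K : Type) →+* ℂ))
    (lefChar_corner_mem_closure_of_ker_le 𝒮 hspan _) h hP hA

/-! ## §4 The products `∏_j A_{(K,Θ_j)}` themselves, and the GLOBAL per-orbit form of the face-period chain -/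

/-- **`HodgeConjectureFor (∏_j A_{(K,Θ_j)})` from period witnesses on one face per orbit of type squares of `K`.**
(`Model.hodgeConjectureFor_cmProdAV_of_faceSet` of `CorCM/FacePeriodsGeneratingSet.lean` at the tree theorems, `hgen` discharged by
`lefChar_corner_mem_closure_of_squareOrbits`, Weil lines from witnesses by `weilFaceAlgebraic_of_exists_facePeriod`.)
[cite: Pohlmann1968, Thm. 1] [cite: Andre1992HodgeCM, Théorème (pp. 4–5)] -/
theorem hodgeConjectureFor_cmProdAV_of_exists_facePeriod_on_squareOrbits (K : CMField) [hGal : IsGalois ℚ K]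
    (h6 : 6 ≤ Module.finrank ℚ K) (𝒮 : Set (Face K))
    (hrep : ∀ f : Face K, ∃ g ∈ 𝒮, ∃ τ : K ≃+* K,
      ((InfinitePlace.mk f.p = InfinitePlace.mk (g.twist τ).p ∧ InfinitePlace.mk f.p' = InfinitePlace.mk (g.twist τ).p') ∨
        (InfinitePlace.mk f.p = InfinitePlace.mk (g.twist τ).p' ∧ InfinitePlace.mk f.p' = InfinitePlace.mk (g.twist τ).p)) ∧
      (f.Φ = (g.twist τ).Φ ∨ f.Φ = flip (g.twist τ).p (g.twist τ).Φ ∨ f.Φ = flip (g.twist τ).p' (g.twist τ).Φ ∨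
        f.Φ = flip (g.twist τ).p' (flip (g.twist τ).p (g.twist τ).Φ)))
    (h : ∀ f ∈ 𝒮, ∃ ι₁ : K →+* ℂ, f.Admissible ι₁ ∧ ∃ (V : HermSpace3 K ι₁) (σ : K →+* ℂ),
      (Model.picardCMUniverse exists_isReal_hodgeModel_holds hodgePQ_independent_of_hodgeModel_holds
        BallQuotient.ballQuotientUniformised_holds cmAbelianVarietyRealised_holds).PeriodNV ι₁ V K f.psi σ)
    {n : ℕ} (Θ : Fin (n + 1) → CMType K) :
    HodgeConjectureFor (cmProdAV K cmAbelianVarietyRealised_holds n Θ).dim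
      (cmProdAV K cmAbelianVarietyRealised_holds n Θ).X :=
  Model.hodgeConjectureFor_cmProdAV_of_faceSet _ _ _ _ deligneMilne1982_Thm_6_20_full_holds hGal h6 𝒮
    (Classical.arbitrary ((K : Type) →+* ℂ))
    (lefChar_corner_mem_closure_of_squareOrbits 𝒮 hrep (Classical.arbitrary ((K : Type) →+* ℂ)))
    (fun f hf => weilFaceAlgebraic_of_exists_facePeriod hGal f (h f hf)) Θ

/-- **GLOBAL PER-ORBIT FORM OF THE FACE-PERIOD CHAIN.**  If for every CM field `K` Galois over `ℚ` with `6 ≤ [K:ℚ]` there is a set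
`𝒮` of faces of `K` meeting every `Aut(K)`-orbit of type squares (every face of `K` shares its square with a Galois twist of a member
of `𝒮`) with ONE period witness on the universe of record per member of `𝒮`, then `HC_CM`.  Compare the all-faces form
`hc_cm_closed_of_exists_facePeriod` (`CorCM/FacePeriodWitnesses.lean`): the hypothesis here asks for one witness per ORBIT, each with
its own admissible `ι₁`, `V`, level and `σ` — by the character calculus, not by transporting periods.  (`SliceExhaustion.
hc_cm_of_forall_galois_cmProdAV` at `cmAbelianVarietyRealised_holds` over §4's slice theorem.)  FRAMING: a conditional reduction;
`HC_CM` is NOT proved and no witness is constructed anywhere in the tree. [cite: Milne2020HodgeClassesAV, proof of Theorem 1]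
[cite: Pohlmann1968, Thm. 1] [cite: Andre1992HodgeCM, Théorème (pp. 4–5)] -/
theorem hc_cm_of_exists_facePeriod_on_squareOrbits
    (h : ∀ (K : CMField) [IsGalois ℚ K], 6 ≤ Module.finrank ℚ K → ∃ 𝒮 : Set (Face K),
      (∀ f : Face K, ∃ g ∈ 𝒮, ∃ τ : K ≃+* K,
        ((InfinitePlace.mk f.p = InfinitePlace.mk (g.twist τ).p ∧ InfinitePlace.mk f.p' = InfinitePlace.mk (g.twist τ).p') ∨
          (InfinitePlace.mk f.p = InfinitePlace.mk (g.twist τ).p' ∧ InfinitePlace.mk f.p' = InfinitePlace.mk (g.twist τ).p)) ∧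
        (f.Φ = (g.twist τ).Φ ∨ f.Φ = flip (g.twist τ).p (g.twist τ).Φ ∨ f.Φ = flip (g.twist τ).p' (g.twist τ).Φ ∨
          f.Φ = flip (g.twist τ).p' (flip (g.twist τ).p (g.twist τ).Φ))) ∧
      ∀ g ∈ 𝒮, ∃ ι₁ : K →+* ℂ, g.Admissible ι₁ ∧ ∃ (V : HermSpace3 K ι₁) (σ : K →+* ℂ),
        (Model.picardCMUniverse exists_isReal_hodgeModel_holds hodgePQ_independent_of_hodgeModel_holds
          BallQuotient.ballQuotientUniformised_holds cmAbelianVarietyRealised_holds).PeriodNV ι₁ V K g.psi σ) :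
    HC_CM := by
  refine SliceExhaustion.hc_cm_of_forall_galois_cmProdAV cmAbelianVarietyRealised_holds ?_
  intro F _ _ _ hGal h6 n Θ
  haveI : IsGalois ℚ (CMField.mk F) := hGal
  obtain ⟨𝒮, hrep, hw⟩ := h (CMField.mk F) h6
  exact hodgeConjectureFor_cmProdAV_of_exists_facePeriod_on_squareOrbits (CMField.mk F) h6 𝒮 hrep hw Θ

/-- **`HodgeConjectureFor (∏_j A_{(K,Θ_j)})` from period witnesses on a set of faces of `K` carrying a generation certificate**
(`ker (typeSum (GalT K) conjT) ≤ span ℤ {gface-reads of 𝒮} ⊔ pairRel`; `Model.hodgeConjectureFor_cmProdAV_of_faceSet` with `hgen`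
discharged by `lefChar_corner_mem_closure_of_ker_le`). [cite: Pohlmann1968, Thm. 1] [cite: Andre1992HodgeCM, Théorème (pp. 4–5)] -/
theorem hodgeConjectureFor_cmProdAV_of_exists_facePeriod_of_ker_le (K : CMField) [hGal : IsGalois ℚ K]
    (h6 : 6 ≤ Module.finrank ℚ K) (𝒮 : Set (Face K))
    (hspan : LinearMap.ker (typeSum (GalT K) conjT) ≤
      Submodule.span ℤ {y : CMF (GalT K) conjT →₀ ℤ | ∃ g ∈ 𝒮, ∃ σ : (K : Type) →+* ℂ,
          y = gface conjT conjT_mul_self (pullType g.Φ σ) (translate σ g.p) (translate σ g.p')} ⊔ pairRel)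
    (h : ∀ f ∈ 𝒮, ∃ ι₁ : K →+* ℂ, f.Admissible ι₁ ∧ ∃ (V : HermSpace3 K ι₁) (σ : K →+* ℂ),
      (Model.picardCMUniverse exists_isReal_hodgeModel_holds hodgePQ_independent_of_hodgeModel_holds
        BallQuotient.ballQuotientUniformised_holds cmAbelianVarietyRealised_holds).PeriodNV ι₁ V K f.psi σ)
    {n : ℕ} (Θ : Fin (n + 1) → CMType K) :
    HodgeConjectureFor (cmProdAV K cmAbelianVarietyRealised_holds n Θ).dim
      (cmProdAV K cmAbelianVarietyRealised_holds n Θ).X :=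
  Model.hodgeConjectureFor_cmProdAV_of_faceSet _ _ _ _ deligneMilne1982_Thm_6_20_full_holds hGal h6 𝒮
    (Classical.arbitrary ((K : Type) →+* ℂ))
    (lefChar_corner_mem_closure_of_ker_le 𝒮 hspan (Classical.arbitrary ((K : Type) →+* ℂ)))
    (fun f hf => weilFaceAlgebraic_of_exists_facePeriod hGal f (h f hf)) Θ

/-- **GLOBAL CERTIFICATE FORM OF THE FACE-PERIOD CHAIN.**  The same with, per field, any set `𝒮` of faces whose face relations read at
all base embeddings generate, together with the pairs, the relation lattice `ker (typeSum (GalT K) conjT)` — the form in which a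
generating set smaller than a system of orbit representatives enters.  FRAMING: a conditional reduction; `HC_CM` is NOT proved.
[cite: Milne2020HodgeClassesAV, proof of Theorem 1] [cite: Pohlmann1968, Thm. 1] -/
theorem hc_cm_of_exists_facePeriod_of_ker_le
    (h : ∀ (K : CMField) [IsGalois ℚ K], 6 ≤ Module.finrank ℚ K → ∃ 𝒮 : Set (Face K),
      LinearMap.ker (typeSum (GalT K) conjT) ≤
        Submodule.span ℤ {y : CMF (GalT K) conjT →₀ ℤ | ∃ g ∈ 𝒮, ∃ σ : (K : Type) →+* ℂ,
            y = gface conjT conjT_mul_self (pullType g.Φ σ) (translate σ g.p) (translate σ g.p')} ⊔ pairRel ∧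
      ∀ g ∈ 𝒮, ∃ ι₁ : K →+* ℂ, g.Admissible ι₁ ∧ ∃ (V : HermSpace3 K ι₁) (σ : K →+* ℂ),
        (Model.picardCMUniverse exists_isReal_hodgeModel_holds hodgePQ_independent_of_hodgeModel_holds
          BallQuotient.ballQuotientUniformised_holds cmAbelianVarietyRealised_holds).PeriodNV ι₁ V K g.psi σ) :
    HC_CM := by
  refine SliceExhaustion.hc_cm_of_forall_galois_cmProdAV cmAbelianVarietyRealised_holds ?_
  intro F _ _ _ hGal h6 n Θ
  haveI : IsGalois ℚ (CMField.mk F) := hGal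
  obtain ⟨𝒮, hspan, hw⟩ := h (CMField.mk F) h6
  exact hodgeConjectureFor_cmProdAV_of_exists_facePeriod_of_ker_le (CMField.mk F) h6 𝒮 hspan hw Θ

end Summit.HodgeConjecture.CorCM

end
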